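import Literature.Barriers.Parity.BrunTitchmarshSiegelZero
import Literature.NumberTheory.LFunctions.ZetaMulMeanValue
import Literature.NumberTheory.LFunctions.PrimeNumberTheoremProgressions
import Literature.NumberTheory.Sieve.SieveFramework
import Mathlib.NumberTheory.ZetaValues
import Mathlib.Analysis.Real.Pi.Bounds
import HarnessLib

/-!
# Tools for the proof of Motohashi's theorem (`BrunTitchmarshSiegelZero`): class counting,
# the inert primes under Brun–Titchmarsh, the prime number theorem, and small estimates

Topic `Literature/Barriers/Parity`. Everything in this file is PROVED. It collects the elementary
inputs of the lower-bound side (Motohashi's (4)) of the proof of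
`Literature.Barriers.Parity.BrunTitchmarshSiegelZero` carried out in
`BrunTitchmarshSiegelZeroProofs.lean`:

* `two_mul_card_negClasses` — for a quadratic `χ ≠ 1` mod `q`, exactly `φ(q)/2` of the residues
  `a mod q` have `χ(a) = −1` (`∑_{a mod q} χ(a) = 0` and `#{χ ≠ 0} = φ(q)`);
* `card_inertPrimes_le` — hence, if `π(N; q, a) ≤ (2 − ξ) N/(φ(q) log(N/q))` for every reduced class
  (`UniformBrunTitchmarsh` at `x = N`), the primes `p ≤ N` with `χ(p) = −1` number at most
  `(1 − ξ/2) N / log(N/q)` ("by (1)", Motohashi p. 191);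
* `exists_card_primes_ge` — the prime number theorem in the form `#{p ≤ N} log N ≥ (1 − ε) N` for
  `N ≥ N₁(ε)` (from the tree's `chebyshevTheta_sub_self_isLittleO`);
* `two_mul_card_splitPrimes_le_convSum`, `two_mul_card_splitPrimes_le_sifted` — the split primes
  (`χ(p) = 1`, `r(p) = 2`) are counted twice by `∑ r(n)` and survive the sieve when `p > w`;
* `LOne_le` (`L(1, χ) ≤ 2q`), `three_pow_cardDistinctFactors_le` (`3^{ω(d)} ≤ τ(d)²`), and the
  growth lemma `eventually_mul_rpow_mul_log_le` (`K w^a log w ≤ ε w^b` eventually, for `a < b`).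

## References

* Y. Motohashi, *A note on Siegel's zeros*, Proc. Japan Acad. 55A (1979) 190–192, proof of the
  Theorem, (4). [cite: Motohashi1979SiegelZeros, proof of the Theorem, (4)]
* H. L. Montgomery, R. C. Vaughan, *Multiplicative Number Theory I*, Cor. 8.8 (prime number theorem;
  tree `PrimeNumberTheoremProgressions.lean`). [cite: MontgomeryVaughan2007, Thm. 6.9 (main term) and Cor. 8.8]
-/

noncomputable section

open Finset Filter Topology Asymptotics
open scoped ArithmeticFunction.omega

namespace Literature.Barriers.Parity.Motohashi1979

open Literature.NumberTheory.LFunctions Literature.NumberTheory.LFunctions.ZetaMul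
  Literature.NumberTheory.LFunctions.DirichletAbel Literature.NumberTheory.Sieve

variable {q : ℕ} [NeZero q] (χ : DirichletCharacter ℂ q)

/-! ### Class counting: `#{a mod q : χ(a) = −1} = φ(q)/2` -/

/-- The residues `a < q` with `χ(a) = −1`. [folklore] -/
def negClasses : Finset ℕ := (range q).filter fun a : ℕ => (χ (a : ZMod q)).re = -1

omit [NeZero q] in
/-- A residue with `χ(a) = −1` is reduced. [folklore] -/
theorem coprime_of_mem_negClasses {a : ℕ} (ha : a ∈ negClasses χ) : a.Coprime q := by
  rw [negClasses, Finset.mem_filter] at ha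
  have hne : χ (a : ZMod q) ≠ 0 := fun h => by rw [h] at ha; norm_num at ha
  by_contra hc
  exact hne (MulChar.map_nonunit χ (mt (ZMod.isUnit_iff_coprime a q).mp hc))

/-- **`#{a mod q : χ(a) = −1} = φ(q)/2`** for a quadratic `χ ≠ 1`: `∑_{a mod q} χ(a) = 0` gives
`#{χ = 1} = #{χ = −1}`, and `#{χ = 1} + #{χ = −1} = #{a : (a, q) = 1} = φ(q)`. [folklore] -/
theorem two_mul_card_negClasses (hχ : χ ≠ 1) (hq : χ ^ 2 = 1) :
    2 * ((negClasses χ).card : ℝ) = Nat.totient q := by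
  classical
  set f : ℕ → ℝ := fun a => (χ (a : ZMod q)).re with hf
  have htri : ∀ a : ℕ, f a = 0 ∨ f a = 1 ∨ f a = -1 := fun a => by
    rcases MulChar.isQuadratic_iff_sq_eq_one.mpr hq (a : ZMod q) with h | h | h <;> simp [hf, h]
  -- `∑_{a < q} χ(a) = 0`
  have hsum : ∑ a ∈ range q, f a = 0 := by
    have h := sum_range_apply_add_eq_zero χ hχ 0
    simp only [zero_add] at h
    have := congrArg Complex.re h
    rw [Complex.re_sum] at this
    simpa [hf] using this
  -- `∑ f = #{f = 1} − #{f = −1}`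
  have hdiff : ∑ a ∈ range q, f a =
      (((range q).filter fun a => f a = 1).card : ℝ) - ((range q).filter fun a => f a = -1).card := by
    have hpt : ∀ a ∈ range q, f a = (if f a = 1 then (1 : ℝ) else 0) - (if f a = -1 then 1 else 0) := by
      intro a _
      rcases htri a with h | h | h <;> norm_num [h]
    rw [Finset.sum_congr rfl hpt, Finset.sum_sub_distrib, Finset.sum_boole, Finset.sum_boole]
  -- `#{f = 1} + #{f = −1} = φ(q)`
  have hunion : ((range q).filter fun a => f a = 1) ∪ ((range q).filter fun a => f a = -1) =
      (range q).filter fun a => q.Coprime a := by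
    rw [← Finset.filter_or]
    refine Finset.filter_congr fun a _ => ?_
    constructor
    · intro h
      have hne : χ (a : ZMod q) ≠ 0 := fun h0 => by
        rcases h with h | h <;> simp [hf, h0] at h
      rw [Nat.coprime_comm]
      by_contra hc
      exact hne (MulChar.map_nonunit χ (mt (ZMod.isUnit_iff_coprime a q).mp hc))
    · intro hc
      have hu : IsUnit (a : ZMod q) := (ZMod.isUnit_iff_coprime a q).mpr (Nat.coprime_comm.mp hc)
      have hne : χ (a : ZMod q) ≠ 0 := (hu.map χ).ne_zero
      rcases htri a with h | h | h
      · exfalso; apply hne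
        simp only [hf] at h
        exact Complex.ext (by simpa using h) (by simpa using apply_im_eq_zero χ hq (a : ZMod q))
      · exact Or.inl h
      · exact Or.inr h
  have hdisj : Disjoint ((range q).filter fun a => f a = 1) ((range q).filter fun a => f a = -1) := by
    rw [Finset.disjoint_filter]; intro a _ h1 h2; rw [h1] at h2; norm_num at h2
  have hcard : (((range q).filter fun a => f a = 1).card : ℝ) + ((range q).filter fun a => f a = -1).card =
      Nat.totient q := by
    rw [Nat.totient_eq_card_coprime, ← hunion, Finset.card_union_of_disjoint hdisj, Nat.cast_add]
  have hneg : negClasses χ = (range q).filter fun a => f a = -1 := rfl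
  rw [hneg]
  linarith [hsum, hdiff, hcard]

/-! ### The inert primes under Brun–Titchmarsh -/

/-- The primes `p ≤ N` with `χ(p) = −1`. [folklore] -/
def inertPrimes (N : ℕ) : Finset ℕ :=
  (Ioc 0 N).filter fun p : ℕ => p.Prime ∧ (χ (p : ZMod q)).re = -1

/-- The primes `w < p ≤ N` with `χ(p) = 1`. [folklore] -/
def splitPrimes (w N : ℕ) : Finset ℕ :=
  (Ioc 0 N).filter fun p : ℕ => p.Prime ∧ (χ (p : ZMod q)).re = 1 ∧ w < p

/-- **The inert primes under (1)** (Motohashi p. 191, "by (1)"): if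
`π(N; q, a) ≤ (2 − ξ) N/(φ(q) log(N/q))` for every reduced class `a`, then
`#{p ≤ N : χ(p) = −1} ≤ (1 − ξ/2) N/log(N/q)` (sum (1) over the `φ(q)/2` classes with `χ(a) = −1`).
[cite: Motohashi1979SiegelZeros, proof of the Theorem, (4)] -/
theorem card_inertPrimes_le (hχ : χ ≠ 1) (hq : χ ^ 2 = 1) {ξ : ℝ} {N : ℕ}
    (hBT : ∀ a : ℕ, a.Coprime q →
      (LevelOfDistribution.primeCountingMod q a N : ℝ) ≤
        (2 - ξ) * N / (Nat.totient q * Real.log ((N : ℝ) / q))) :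
    ((inertPrimes χ N).card : ℝ) ≤ (1 - ξ / 2) * N / Real.log ((N : ℝ) / q) := by
  classical
  have hq0 : 0 < q := NeZero.pos q
  -- fibre the inert primes over their residues
  have hmaps : ∀ p ∈ inertPrimes χ N, p % q ∈ negClasses χ := by
    intro p hp
    rw [inertPrimes, Finset.mem_filter] at hp
    rw [negClasses, Finset.mem_filter, Finset.mem_range]
    exact ⟨Nat.mod_lt p hq0, by rw [ZMod.natCast_mod]; exact hp.2.2⟩
  have hcard := Finset.card_eq_sum_card_fiberwise hmaps
  have hfib : ∀ a ∈ negClasses χ,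
      (((inertPrimes χ N).filter fun p => p % q = a).card : ℝ) ≤
        (2 - ξ) * N / (Nat.totient q * Real.log ((N : ℝ) / q)) := by
    intro a ha
    refine le_trans ?_ (hBT a (coprime_of_mem_negClasses χ ha))
    have hsub : (inertPrimes χ N).filter (fun p => p % q = a) ⊆
        (range (N + 1)).filter (fun p : ℕ => p.Prime ∧ p ≡ a [MOD q]) := by
      intro p hp
      rw [Finset.mem_filter, inertPrimes, Finset.mem_filter, Finset.mem_Ioc] at hp
      rw [Finset.mem_filter, Finset.mem_range]
      refine ⟨Nat.lt_succ_of_le hp.1.1.2, hp.1.2.1, ?_⟩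
      have ha' : a < q := Finset.mem_range.mp (Finset.mem_filter.mp ha).1
      rw [Nat.ModEq, hp.2, Nat.mod_eq_of_lt ha']
    exact_mod_cast Finset.card_le_card hsub
  calc ((inertPrimes χ N).card : ℝ)
      = ∑ a ∈ negClasses χ, (((inertPrimes χ N).filter fun p => p % q = a).card : ℝ) := by
        rw [hcard]; push_cast; rfl
    _ ≤ ∑ a ∈ negClasses χ, (2 - ξ) * N / (Nat.totient q * Real.log ((N : ℝ) / q)) :=
        Finset.sum_le_sum hfib
    _ = (negClasses χ).card * ((2 - ξ) * N / (Nat.totient q * Real.log ((N : ℝ) / q))) := by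
        rw [Finset.sum_const, nsmul_eq_mul]
    _ = (1 - ξ / 2) * N / Real.log ((N : ℝ) / q) := by
        have h2 := two_mul_card_negClasses χ hχ hq
        have hφ : (0 : ℝ) < Nat.totient q := by exact_mod_cast Nat.totient_pos.mpr hq0
        rw [show ((negClasses χ).card : ℝ) = Nat.totient q / 2 by linarith]
        field_simp

/-! ### The split primes are counted twice -/

omit [NeZero q] in
/-- At a prime, `r(p) = 1 + χ(p)`; at a split prime `r(p) = 2`. [folklore] -/
theorem coeff_eq_two_of_split {p : ℕ} (hp : p.Prime) (h : (χ (p : ZMod q)).re = 1) :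
    coeff χ p = 2 := by
  rw [coeff_prime χ hp, h]; norm_num

omit [NeZero q] in
/-- `2 · #{p ≤ N : χ(p) = 1, p > w} ≤ ∑_{n ≤ N} r(n)`. [folklore] -/
theorem two_mul_card_splitPrimes_le_convSum (hq : χ ^ 2 = 1) (w N : ℕ) :
    2 * ((splitPrimes χ w N).card : ℝ) ≤ convSum χ N := by
  rw [convSum]
  calc 2 * ((splitPrimes χ w N).card : ℝ) = ∑ p ∈ splitPrimes χ w N, (2 : ℝ) := by
        rw [Finset.sum_const, nsmul_eq_mul, mul_comm]
    _ = ∑ p ∈ splitPrimes χ w N, coeff χ p :=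
        Finset.sum_congr rfl fun p hp => by
          rw [splitPrimes, Finset.mem_filter] at hp
          rw [coeff_eq_two_of_split χ hp.2.1 hp.2.2.1]
    _ ≤ ∑ n ∈ Ioc 0 N, coeff χ n :=
        Finset.sum_le_sum_of_subset_of_nonneg (Finset.filter_subset _ _) fun n _ _ => coeff_nonneg χ hq n

omit [NeZero q] in
/-- **The split primes survive the sieve** (Motohashi's `I(N, N^{1/2}) ≥ ∑_{N^{1/2} < p ≤ N} B(p)`):
`2 · #{w < p ≤ N : χ(p) = 1} ≤ ∑_{n ≤ N, (n, P) = 1} r(n)`, `P = ∏_{p ≤ w} p`.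
[cite: Motohashi1979SiegelZeros, proof of the Theorem, (4)] -/
theorem two_mul_card_splitPrimes_le_sifted (hq : χ ^ 2 = 1) (w N : ℕ) :
    2 * ((splitPrimes χ w N).card : ℝ) ≤
      ∑ n ∈ (Ioc 0 N).filter (fun n : ℕ => n.Coprime (primesProdBelow ((w : ℝ) + 1))), coeff χ n := by
  classical
  have hsub : splitPrimes χ w N ⊆
      (Ioc 0 N).filter (fun n : ℕ => n.Coprime (primesProdBelow ((w : ℝ) + 1))) := by
    intro p hp
    rw [splitPrimes, Finset.mem_filter] at hp
    rw [Finset.mem_filter, coprime_primesProdBelow_iff]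
    refine ⟨hp.1, fun r hr hrp => ?_⟩
    rw [Nat.mem_primesBelow] at hr
    have hrp' : r = p := (Nat.prime_dvd_prime_iff_eq hr.2 hp.2.1).mp hrp
    have hceil : ⌈(w : ℝ) + 1⌉₊ = w + 1 := by exact_mod_cast Nat.ceil_natCast (w + 1)
    have := hr.1
    rw [hceil, hrp'] at this
    exact absurd hp.2.2.2 (by omega)
  calc 2 * ((splitPrimes χ w N).card : ℝ) = ∑ p ∈ splitPrimes χ w N, (2 : ℝ) := by
        rw [Finset.sum_const, nsmul_eq_mul, mul_comm]
    _ = ∑ p ∈ splitPrimes χ w N, coeff χ p :=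
        Finset.sum_congr rfl fun p hp => by
          rw [splitPrimes, Finset.mem_filter] at hp
          rw [coeff_eq_two_of_split χ hp.2.1 hp.2.2.1]
    _ ≤ _ := Finset.sum_le_sum_of_subset_of_nonneg hsub fun n _ _ => coeff_nonneg χ hq n

/-- **Counting the split primes**: `#{w < p ≤ N : χ(p) = 1} ≥ #{p ≤ N} − w − #{p ∣ q} − #{inert p ≤ N}`,
with `#{p ∣ q} ≤ q`. [folklore] -/
theorem card_primes_le_card_splitPrimes_add (hq : χ ^ 2 = 1) (w N : ℕ) :
    (((Ioc 0 N).filter Nat.Prime).card : ℝ) ≤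
      (splitPrimes χ w N).card + (inertPrimes χ N).card + w + q := by
  classical
  -- every prime `p ≤ N` is split with `p > w`, inert, `≤ w`, or divides `q`
  have hcover : (Ioc 0 N).filter Nat.Prime ⊆
      splitPrimes χ w N ∪ inertPrimes χ N ∪ Ioc 0 w ∪ (Ioc 0 q).filter (· ∣ q) := by
    intro p hp
    rw [Finset.mem_filter] at hp
    simp only [Finset.mem_union, splitPrimes, inertPrimes, Finset.mem_filter, Finset.mem_Ioc]
    rcases MulChar.isQuadratic_iff_sq_eq_one.mpr hq (p : ZMod q) with h | h | h
    · -- `χ(p) = 0`: `p ∣ q`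
      right
      have hnu : ¬ IsUnit (p : ZMod q) := fun hu => (hu.map χ).ne_zero h
      rw [ZMod.isUnit_iff_coprime, Nat.Prime.coprime_iff_not_dvd hp.2, not_not] at hnu
      exact ⟨⟨hp.2.pos, Nat.le_of_dvd (NeZero.pos q) hnu⟩, hnu⟩
    · by_cases hw : w < p
      · left; left; left; exact ⟨Finset.mem_Ioc.mp hp.1, hp.2, by simp [h], hw⟩
      · left; right
        exact ⟨hp.2.pos, not_lt.mp hw⟩
    · left; left; right; exact ⟨Finset.mem_Ioc.mp hp.1, hp.2, by simp [h]⟩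
  have h1 := Finset.card_le_card hcover
  have h2 : (splitPrimes χ w N ∪ inertPrimes χ N ∪ Ioc 0 w ∪ (Ioc 0 q).filter (· ∣ q)).card ≤
      (splitPrimes χ w N).card + (inertPrimes χ N).card + w + q := by
    refine (Finset.card_union_le _ _).trans (add_le_add ((Finset.card_union_le _ _).trans
      (add_le_add ((Finset.card_union_le _ _)) (by simp))) ?_)
    exact (Finset.card_filter_le _ _).trans (by simp)
  exact_mod_cast h1.trans h2

/-! ### The prime number theorem -/

/-- **Prime number theorem, counting form**: for `ε > 0` there is `N₁` with
`(1 − ε) N ≤ #{p ≤ N} · log N` for all `N ≥ N₁` (from `θ(N) = N + o(N)`, tree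
`chebyshevTheta_sub_self_isLittleO`, and `θ(N) ≤ #{p ≤ N} log N`).
[cite: MontgomeryVaughan2007, Thm. 6.9 (main term) and Cor. 8.8] -/
theorem exists_card_primes_ge {ε : ℝ} (hε : 0 < ε) :
    ∃ N₁ : ℕ, ∀ N : ℕ, N₁ ≤ N → (1 - ε) * N ≤ (((Ioc 0 N).filter Nat.Prime).card : ℝ) * Real.log N := by
  have h := (chebyshevTheta_sub_self_isLittleO.def hε)
  rw [Filter.eventually_atTop] at h
  obtain ⟨N₁, hN₁⟩ := h
  refine ⟨N₁, fun N hN => ?_⟩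
  have hb := hN₁ N hN
  rw [Real.norm_eq_abs, Real.norm_eq_abs, Nat.abs_cast] at hb
  have hθ : (1 - ε) * N ≤ Chebyshev.theta N := by
    have := (abs_le.mp hb).1; linarith
  refine hθ.trans ?_
  rw [Chebyshev.theta, Nat.floor_natCast]
  calc ∑ p ∈ (Ioc 0 N).filter Nat.Prime, Real.log p
      ≤ ∑ p ∈ (Ioc 0 N).filter Nat.Prime, Real.log N := by
        refine Finset.sum_le_sum fun p hp => ?_
        rw [Finset.mem_filter, Finset.mem_Ioc] at hp
        exact Real.log_le_log (by exact_mod_cast hp.1.1) (by exact_mod_cast hp.1.2)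
    _ = (((Ioc 0 N).filter Nat.Prime).card : ℝ) * Real.log N := by
        rw [Finset.sum_const, nsmul_eq_mul]

/-! ### Small estimates -/

/-- `∑_{n ≥ 0} (n+1)^{-2} ≤ 2` (Basel: `π²/6`). [folklore] -/
theorem tsum_rpow_neg_two_le_two : ∑' n : ℕ, ((n + 1 : ℕ) : ℝ) ^ (-(1 : ℝ) - 1) ≤ 2 := by
  have h1 : HasSum (fun n : ℕ => (1 : ℝ) / ((n + 1 : ℕ) : ℝ) ^ 2) (Real.pi ^ 2 / 6 - ∑ i ∈ range 1, (1 : ℝ) / (i : ℝ) ^ 2) :=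
    (hasSum_nat_add_iff' 1).mpr hasSum_zeta_two
  simp only [Finset.sum_range_one, Nat.cast_zero, ne_eq, OfNat.ofNat_ne_zero, not_false_eq_true,
    zero_pow, div_zero, sub_zero] at h1
  have h2 : ∀ n : ℕ, ((n + 1 : ℕ) : ℝ) ^ (-(1 : ℝ) - 1) = 1 / ((n + 1 : ℕ) : ℝ) ^ 2 := by
    intro n
    have hn : (0 : ℝ) < ((n + 1 : ℕ) : ℝ) := by positivity
    rw [show (-(1 : ℝ) - 1) = -(2 : ℝ) by norm_num, Real.rpow_neg hn.le, one_div]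
    norm_cast
  simp_rw [h2]
  rw [h1.tsum_eq]
  have := Real.pi_lt_d2
  have hpi : Real.pi ^ 2 < 10 := by nlinarith [Real.pi_pos]
  linarith

/-- **`L(1, χ) ≤ 2q`** for `χ ≠ 1` quadratic (crude: `‖L(1,χ)‖ ≤ q ∑ (n+1)^{-2}`, tree
`DirichletAbel.norm_LFunction_one_le`). [cite: MontgomeryVaughan2007, §4.3 eq. (4.23) with §1.3 Thm. 1.3] -/
theorem LOne_le (hχ : χ ≠ 1) : LOne χ ≤ 2 * q := by
  have h := norm_LFunction_one_le χ hχ one_pos le_rfl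
  rw [Real.rpow_one] at h
  calc LOne χ ≤ ‖χ.LFunction 1‖ := Complex.re_le_norm _
    _ ≤ q * ∑' n : ℕ, ((n + 1 : ℕ) : ℝ) ^ (-(1 : ℝ) - 1) := h
    _ ≤ q * 2 := mul_le_mul_of_nonneg_left tsum_rpow_neg_two_le_two (Nat.cast_nonneg q)
    _ = 2 * q := by ring

/-- `ω(d) = #primeFactors(d)`. [folklore] -/
theorem cardDistinctFactors_eq_card_primeFactors' (d : ℕ) :
    ω d = d.primeFactors.card := by
  rw [ArithmeticFunction.cardDistinctFactors_apply, ← List.card_toFinset]; rfl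

/-- **`3^{ω(d)} ≤ τ(d)²`** for `d ≠ 0` (`2^{ω(d)} ≤ τ(d) = ∏ (v_p + 1)`). [folklore] -/
theorem three_pow_cardDistinctFactors_le {d : ℕ} (hd : d ≠ 0) :
    (3 : ℝ) ^ ω d ≤ ((d.divisors.card : ℝ)) ^ 2 := by
  have h2 : 2 ^ d.primeFactors.card ≤ d.divisors.card := by
    rw [Nat.card_divisors hd]
    refine Finset.pow_card_le_prod _ _ _ fun p hp => ?_
    have := Nat.mem_primeFactors.mp hp
    have hpos : 0 < d.factorization p := this.1.factorization_pos_of_dvd hd this.2.1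
    omega
  have h2' : (2 : ℝ) ^ d.primeFactors.card ≤ (d.divisors.card : ℝ) := by exact_mod_cast h2
  rw [cardDistinctFactors_eq_card_primeFactors']
  calc (3 : ℝ) ^ d.primeFactors.card ≤ (4 : ℝ) ^ d.primeFactors.card :=
        pow_le_pow_left₀ (by norm_num) (by norm_num) _
    _ = ((2 : ℝ) ^ d.primeFactors.card) ^ 2 := by
        rw [← pow_mul, mul_comm, pow_mul]; norm_num
    _ ≤ (d.divisors.card : ℝ) ^ 2 := by gcongr

/-- **Growth lemma**: for `a < b`, `K ≥ 0`, `ε > 0`, eventually in `w : ℕ`,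
`K w^a log w ≤ ε w^b` (`log w = o(w^{b−a})`, Mathlib `isLittleO_log_rpow_atTop`). [folklore] -/
theorem eventually_mul_rpow_mul_log_le {a b K ε : ℝ} (hab : a < b) (hK : 0 ≤ K) (hε : 0 < ε) :
    ∀ᶠ w : ℕ in atTop, K * (w : ℝ) ^ a * Real.log w ≤ ε * (w : ℝ) ^ b := by
  have hr : 0 < b - a := by linarith
  rcases eq_or_lt_of_le hK with rfl | hK0
  · filter_upwards with w
    simp only [zero_mul]; positivity
  have hc : 0 < ε / K := div_pos hε hK0
  have h := ((isLittleO_log_rpow_atTop hr).def hc).and (eventually_ge_atTop 1)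
  have h' := tendsto_natCast_atTop_atTop.eventually h
  filter_upwards [h'] with w hw
  obtain ⟨hw, hw1⟩ := hw
  have hw0 : (0 : ℝ) < w := by linarith
  rw [Real.norm_eq_abs, Real.norm_eq_abs, abs_of_nonneg (Real.log_nonneg hw1),
    abs_of_nonneg (Real.rpow_nonneg hw0.le _)] at hw
  have hwa : 0 < (w : ℝ) ^ a := Real.rpow_pos_of_pos hw0 a
  calc K * (w : ℝ) ^ a * Real.log w ≤ K * (w : ℝ) ^ a * (ε / K * (w : ℝ) ^ (b - a)) :=
        mul_le_mul_of_nonneg_left hw (by positivity)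
    _ = ε * ((w : ℝ) ^ a * (w : ℝ) ^ (b - a)) := by field_simp
    _ = ε * (w : ℝ) ^ b := by rw [← Real.rpow_add hw0]; ring_nf

end Literature.Barriers.Parity.Motohashi1979

end
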